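import Summits.CriticalPhenomena.CardyFormulaZ2.Theses.CardySelfRefinement
import Literature.Probability.Percolation.QuadCrossingSpaceZ2
import Literature.Probability.Percolation.QuadCrossingSubseqLimits
import Literature.Probability.LatticeModels.MedialInterfaceProofs
import Literature.Probability.LatticeModels.MedialExplorationChains
import Literature.Probability.Percolation.InterfaceCurves
import HarnessLib

/-!
# Chordality of the hand-off family: the `IsChordal` conjunct of stub `stub_freeAxioms` of line
`crosscut-dictionary` for crux `LagHandOff` (stmt-CriticalPhenomena-10268)

Partial helper for the registered stub `stub_freeAxioms` (namespace
`Summit.CriticalPhenomena.CardyFormulaZ2.Cruxes.LagHandOff.CrosscutDictionary`): of its four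
conjuncts (chordal, local, target independent, a.s. no boundary tracing) this file proves the
first, `isChordal_of_handsOff`, with the stub's hypotheses verbatim (only measurability `h1`,
the joint hand-off `h3` and discretisability `h4` are used; equivariance is not needed):
for a Borel reading `Ψ D : ℋ_ℂ → CurveClass ℂ` to which the bond-`ℤ²` interfaces of every
Dobrushin domain `D` and every admissible discretisation family `E` hand off jointly along every
quad-convergent positive null mesh sequence, and every `μ ∈ subseqQuadLimits univ`, the family
`P D := (Ψ D)_* μ` satisfies `ChordalFamily.IsChordal`.

Proof.  `P D` is a probability law (`isProbabilityMeasure_of_isSubseqQuadLimit`).  For the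
a.s. clause, `isSubseqQuadLimit_iff` gives a mesh sequence `δs → 0⁺` with `μ_{δs n} → μ`, `h4`
an admissible family `E` of `D`, and `h3` the joint convergence.  DISCRETE INPUT (all `ω`, all
small `δ`, sorry-free lattice bookkeeping on top of `isMedialExploration_medialExploration_holds`):
the exploration polygon starts and ends at the midpoints of the two `A`–`B` edges
(`IsMedialExploration.head_mem/getLast_mem/head_ne_getLast`, `ncard_zdABEdges_eq_two`), which are
Hausdorff-close to `{a, b}` (`ZdDiscretisationFamily.tendsto_zdABEdges`), so the endpoint rule
`orientCurve` puts its source within `ρ` of `a` and its target within `ρ` of `b`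
(`eventually_forall_bondInterfaceIn_near`); every point of the polygon is within one mesh of the
primal vertex of its current medial dart, a corner of an inner face, hence of `D`
(`exists_mem_dist_medialExplorationCurve_le`), so the trace lies in `cthickening ρ D̄`.
LIMIT: an eventually-sure CLOSED event passes to `Ψ D S` for `μ`-a.e. `S` by testing `h3` on the
bounded continuous function `min 1 (infDist · F) ∘ snd`, whose integrals vanish eventually
(`ae_mem_of_handsOff`; no portmanteau machinery needed); intersect over `ρ = 1/(k+1)` and use
`closure D̄ = ⋂_ρ cthickening ρ D̄`.

The other three conjuncts (LSW locality, target independence, no boundary tracing) are NOT here: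
they need exact lattice identities for compatible admissible discretisations of nested / 3-marked
domains, a.s. continuity of `CurveClass.stopAt` at the limit law, and boundary three-arm (RSW)
estimates on `ℤ²`; see the worker log of `stub_freeAxioms`.

References: S. Smirnov, C. R. Acad. Sci. 333 (2001) §2 (exploration path from `a_δ` to `b_δ`);
F. Camia, C. M. Newman, PTRF 139 (2007) §2; M. Aizenman, A. Burchard, Duke Math. J. 99 (1999)
§2.1 (curve space; endpoints and traces are continuous / upper semicontinuous functionals).
-/

noncomputable section

open MeasureTheory Filter Set Topology
open scoped BoundedContinuousFunction
open Literature.Probability.Percolation Literature.Probability.LatticeModels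
open Literature.Probability.RandomPlanarGeometry Literature.Probability.Percolation.QuadCrossing
open Summit.CriticalPhenomena.CardyFormulaZ2.Theses.CardySelfRefinement

namespace Summit.CriticalPhenomena.CardyFormulaZ2.Cruxes.LagHandOff.CrosscutDictionary

/-! ### Lattice facts: the discrete interface starts near `a`, ends near `b`, stays near `D̄` -/

/-- The polyline through the images of a nonempty list starts at the image of its head and ends
at the image of its last element. -/
theorem polyline_map_apply_ends {l : List MedialVertex} (hl : l ≠ []) (φ : MedialVertex → ℂ) :
    polyline (l.map φ) 0 = φ (l.head hl) ∧ polyline (l.map φ) 1 = φ (l.getLast hl) := by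
  obtain ⟨a, l, rfl⟩ := List.exists_cons_of_ne_nil hl
  refine ⟨?_, ?_⟩
  · rw [List.map_cons, polyline_apply_zero, List.head_cons]
  · rw [List.map_cons, polyline_apply_one]
    exact List.getLast_map (l := a :: l) (by simp)

/-- In a set with exactly two elements, two distinct members exhaust it. -/
theorem eq_or_eq_of_ncard_eq_two {α : Type*} {s : Set α} (hs : s.ncard = 2) {x y z : α}
    (hx : x ∈ s) (hy : y ∈ s) (hxy : x ≠ y) (hz : z ∈ s) : z = x ∨ z = y := by
  obtain ⟨u, v, huv, rfl⟩ := Set.ncard_eq_two.1 hs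
  simp only [Set.mem_insert_iff, Set.mem_singleton_iff] at hx hy hz
  rcases hx with rfl | rfl <;> rcases hy with rfl | rfl <;> rcases hz with rfl | rfl <;> tauto

/-- **The exploration polygon stays within one mesh of the domain.** For a genuine exploration
path at mesh `δ ≥ 0`, every point of the medial exploration polygon is within `δ` of a mesh point
of the domain `Ω` (the primal vertex on the left of the current medial dart, a corner of an inner
face of `Ω_δ`). -/
theorem exists_mem_dist_medialExplorationCurve_le {Ed : DiscreteDobrushin}
    {ω : BondConfig (Site 2)} (hγ : IsMedialExploration Ed ω (medialExploration Ed ω))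
    (hδ : 0 ≤ Ed.δ) (u : unitInterval) :
    ∃ z ∈ Ed.Ω, dist (medialExplorationCurve Ed ω u) z ≤ Ed.δ := by
  obtain ⟨a, l, hal⟩ := List.exists_cons_of_ne_nil hγ.ne_nil
  rw [hal] at hγ
  have hpos : medialExplorationCurve Ed ω u =
      (polylineFrom (medialPoint Ed.δ a) (l.map (medialPoint Ed.δ))).2 u := by
    rw [medialExplorationCurve, hal]; rfl
  have hseg := polylineFrom_mem_segment_pieceAt (medialPoint Ed.δ a) (l.map (medialPoint Ed.δ)) u
  rw [pieceAt_map] at hseg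
  rw [hpos]
  rcases pieceAt_mem_zip_or a l u with hp | hp
  · obtain ⟨v, f, hv, hf, hs, ht⟩ := hγ.step _ _ (infix_of_mem_zip_tail (a :: l) hp)
    refine ⟨meshPoint Ed.δ v, meshPoint_mem_of_isCorner_of_isInnerFace hv hf, ?_⟩
    have h1 := dist_medialPoint_cornerSource_le hδ hv
    have h2 := dist_medialPoint_cornerTarget_le hδ hv
    rw [hs] at h1
    rw [ht] at h2
    exact Metric.mem_closedBall.1 ((convex_closedBall _ _).segment_subset
      (Metric.mem_closedBall.2 h1) (Metric.mem_closedBall.2 h2) hseg)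
  · rw [hp] at hseg
    simp only [Prod.map_fst, Prod.map_snd, segment_same, Set.mem_singleton_iff] at hseg
    rw [hseg]
    obtain ⟨p, hpmem, hlast⟩ :=
      exists_mem_zip_of_mem (a :: l) hγ.one_lt_length (List.getLast_mem (List.cons_ne_nil a l))
    obtain ⟨v, f, hv, hf, hs, ht⟩ := hγ.step _ _ (infix_of_mem_zip_tail (a :: l) hpmem)
    refine ⟨meshPoint Ed.δ v, meshPoint_mem_of_isCorner_of_isInnerFace hv hf, ?_⟩
    rcases hlast with h | h
    · rw [h, ← hs]; exact dist_medialPoint_cornerSource_le hδ hv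
    · rw [h, ← ht]; exact dist_medialPoint_cornerTarget_le hδ hv

/-- For admissible data the trace of the interface lies in the closed `δ`-neighbourhood of the
domain. -/
theorem range_bondInterfaceIn_subset_cthickening (D : DobrushinDomain) {Ed : DiscreteDobrushin}
    (hD : Ed.IsZdAdmissible) (ω : BondConfig (Site 2)) :
    (bondInterfaceIn D Ed ω).range ⊆ Metric.cthickening Ed.δ Ed.Ω := by
  rw [range_bondInterfaceIn]
  rintro _ ⟨u, rfl⟩
  obtain ⟨z, hz, hdist⟩ := exists_mem_dist_medialExplorationCurve_le
    (isMedialExploration_medialExploration_holds Ed hD ω) hD.delta_pos.le u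
  exact Metric.mem_cthickening_of_dist_le _ z _ _ hz hdist

/-- **The discrete marked points sit at the ends of the exploration polygon.** For admissible
data whose two `A`–`B` edge midpoints are Hausdorff-`r`-close to `{a, b}` with `2r ≤ |a - b|`,
the exploration polygon starts within `r` of `a` and ends within `r` of `b`, or the other way
round. -/
theorem medialExplorationCurve_ends_near (D : DobrushinDomain) {Ed : DiscreteDobrushin}
    (hD : Ed.IsZdAdmissible) (ω : BondConfig (Site 2)) {r : ℝ}
    (h2r : 2 * r ≤ dist (D.pt 0) (D.pt 1))
    (hH : Metric.hausdorffEDist (medialPoint Ed.δ '' Ed.zdABEdges) {D.pt 0, D.pt 1} <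
      ENNReal.ofReal r) :
    (dist (medialExplorationCurve Ed ω 0) (D.pt 0) < r ∧
        dist (medialExplorationCurve Ed ω 1) (D.pt 1) < r) ∨
      (dist (medialExplorationCurve Ed ω 0) (D.pt 1) < r ∧
        dist (medialExplorationCurve Ed ω 1) (D.pt 0) < r) := by
  have hγ := isMedialExploration_medialExploration_holds Ed hD ω
  obtain ⟨h0, h1⟩ := polyline_map_apply_ends hγ.ne_nil (medialPoint Ed.δ)
  simp only [medialExplorationCurve, h0, h1]
  set p := medialPoint Ed.δ ((medialExploration Ed ω).head hγ.ne_nil) with hp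
  set q := medialPoint Ed.δ ((medialExploration Ed ω).getLast hγ.ne_nil) with hq
  have hA : ∀ z ∈ medialPoint Ed.δ '' Ed.zdABEdges, z = p ∨ z = q := by
    rintro _ ⟨e, he, rfl⟩
    rcases eq_or_eq_of_ncard_eq_two hD.ncard_zdABEdges_eq_two hγ.head_mem hγ.getLast_mem
      hγ.head_ne_getLast he with rfl | rfl
    · exact Or.inl rfl
    · exact Or.inr rfl
  have hpA : p ∈ medialPoint Ed.δ '' Ed.zdABEdges := Set.mem_image_of_mem _ hγ.head_mem
  obtain ⟨w, hw, hpw⟩ := Metric.exists_edist_lt_of_hausdorffEDist_lt hpA hH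
  rw [Metric.hausdorffEDist_comm] at hH
  obtain ⟨za, hza, haz⟩ := Metric.exists_edist_lt_of_hausdorffEDist_lt
    (show D.pt 0 ∈ ({D.pt 0, D.pt 1} : Set ℂ) by simp) hH
  obtain ⟨zb, hzb, hbz⟩ := Metric.exists_edist_lt_of_hausdorffEDist_lt
    (show D.pt 1 ∈ ({D.pt 0, D.pt 1} : Set ℂ) by simp) hH
  rw [edist_lt_ofReal] at hpw haz hbz
  have htri := dist_triangle (D.pt 0) p (D.pt 1)
  simp only [Set.mem_insert_iff, Set.mem_singleton_iff] at hw
  rcases hw with rfl | rfl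
  · left
    refine ⟨hpw, ?_⟩
    rcases hA zb hzb with rfl | rfl
    · exfalso
      rw [dist_comm] at hpw hbz
      linarith
    · rw [dist_comm]; exact hbz
  · right
    refine ⟨hpw, ?_⟩
    rcases hA za hza with rfl | rfl
    · exfalso
      linarith
    · rw [dist_comm]; exact haz

/-- **The endpoint rule orients correctly.** If a parametrised curve starts within `r` of `a` and
ends within `r` of `b`, or the other way round, and `2r ≤ |a - b|`, then the re-oriented curve
`orientCurve D` starts within `r` of `a` and ends within `r` of `b`. -/
theorem dist_source_orientCurve_lt (D : DobrushinDomain) (c : C(unitInterval, ℂ)) {r : ℝ}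
    (h2r : 2 * r ≤ dist (D.pt 0) (D.pt 1))
    (h : (dist (c 0) (D.pt 0) < r ∧ dist (c 1) (D.pt 1) < r) ∨
      (dist (c 0) (D.pt 1) < r ∧ dist (c 1) (D.pt 0) < r)) :
    dist (orientCurve D c).source (D.pt 0) < r ∧ dist (orientCurve D c).target (D.pt 1) < r := by
  have htri := dist_triangle (D.pt 0) (c 0) (D.pt 1)
  rw [dist_comm (D.pt 0) (c 0)] at htri
  rcases h with ⟨h0, h1⟩ | ⟨h0, h1⟩
  · have hle : dist (c 0) (D.pt 0) ≤ dist (c 0) (D.pt 1) := by linarith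
    rw [orientCurve_of_le D hle]
    exact ⟨h0, h1⟩
  · have hlt : dist (c 0) (D.pt 1) < dist (c 0) (D.pt 0) := by linarith
    rw [orientCurve_of_lt D hlt]
    change dist (c (unitInterval.symm 0)) _ < r ∧ dist (c (unitInterval.symm 1)) _ < r
    rw [unitInterval.symm_zero, unitInterval.symm_one]
    exact ⟨h1, h0⟩

/-- **Eventually-sure localisation of the discrete interfaces.** For a `ℤ²`-discretisation
family of `(D; a, b)` and `ρ > 0`: for all small meshes `δ > 0` and EVERY configuration `ω`, the
interface `bondInterfaceIn D (E δ) ω` starts within `ρ` of `a`, ends within `ρ` of `b`, and its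
trace lies in the closed `ρ`-neighbourhood of `D̄`. -/
theorem eventually_forall_bondInterfaceIn_near (D : DobrushinDomain) {E : ℝ → DiscreteDobrushin}
    (hE : ZdDiscretisationFamily D E) {ρ : ℝ} (hρ : 0 < ρ) :
    ∀ᶠ δ in 𝓝[>] (0 : ℝ), ∀ ω : BondConfig (Site 2),
      bondInterfaceIn D (E δ) ω ∈ {γ : CurveClass ℂ | dist γ.source (D.pt 0) ≤ ρ ∧
        dist γ.target (D.pt 1) ≤ ρ ∧ γ.range ⊆ Metric.cthickening ρ (closure D.carrier)} := by
  have hab : 0 < dist (D.pt 0) (D.pt 1) := dist_pos.2 (D.pt_injective.ne (by decide))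
  set r := min ρ (dist (D.pt 0) (D.pt 1) / 2) with hr
  have hr0 : 0 < r := lt_min hρ (by positivity)
  have hrρ : r ≤ ρ := min_le_left _ _
  have h2r : 2 * r ≤ dist (D.pt 0) (D.pt 1) := by
    have := min_le_right ρ (dist (D.pt 0) (D.pt 1) / 2)
    linarith
  have hH : ∀ᶠ δ in 𝓝[>] (0 : ℝ), Metric.hausdorffEDist (medialPoint δ '' (E δ).zdABEdges)
      {D.pt 0, D.pt 1} < ENNReal.ofReal r :=
    hE.tendsto_zdABEdges.eventually (Iio_mem_nhds (ENNReal.ofReal_pos.2 hr0))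
  have hsmall : ∀ᶠ δ in 𝓝[>] (0 : ℝ), δ ≤ ρ := mem_nhdsWithin_of_mem_nhds (Iic_mem_nhds hρ)
  filter_upwards [hE.eventually_isZdAdmissible, hH, hsmall] with δ hadm hHδ hδρ ω
  have hδeq : (E δ).δ = δ := hE.δ_eq δ
  have hends := dist_source_orientCurve_lt D (medialExplorationCurve (E δ) ω) h2r
    (medialExplorationCurve_ends_near D hadm ω h2r (by rw [hδeq]; exact hHδ))
  refine ⟨hends.1.le.trans hrρ, hends.2.le.trans hrρ, ?_⟩
  refine (range_bondInterfaceIn_subset_cthickening D hadm ω).trans ?_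
  rw [hE.Ω_eq, hδeq, ← Metric.cthickening_closure]
  exact Metric.cthickening_mono hδρ _

/-! ### Passing eventually-sure closed events through the joint hand-off -/

/-- **Closed, eventually sure events pass to the hand-off reading.** If the pairs
(quad configuration, interface) at meshes `δs n` converge jointly in law to `(S, Ψ D S)`,
`S ∼ μ`, and a closed set `F` of curve classes contains the interface of EVERY configuration for
all large `n`, then `Ψ D S ∈ F` for `μ`-a.e. `S` (test the convergence on the bounded continuous
function `min 1 (infDist · F) ∘ snd`, whose integrals vanish eventually). -/
theorem ae_mem_of_handsOff {Ψ : DobrushinDomain → QuadConfig (Set.univ : Set ℂ) → CurveClass ℂ}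
    {μ : FiniteMeasure (QuadConfig (Set.univ : Set ℂ))} {δs : ℕ → ℝ} {D : DobrushinDomain}
    {E : ℝ → DiscreteDobrushin}
    (h3D : ∀ f : (QuadConfig (Set.univ : Set ℂ) × CurveClass ℂ) →ᵇ ℝ,
      Tendsto (fun n => ∫ ω, f (z2QuadConfig (Set.univ : Set ℂ) (δs n) ω,
          bondInterfaceIn D (E (δs n)) ω) ∂(bondPercolation (zdGraph 2) half))
        atTop (𝓝 (∫ S, f (S, Ψ D S) ∂(μ : Measure (QuadConfig (Set.univ : Set ℂ))))))
    (hΨ : Measurable (Ψ D)) {F : Set (CurveClass ℂ)} (hF : IsClosed F)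
    (hev : ∀ᶠ n in atTop, ∀ ω, bondInterfaceIn D (E (δs n)) ω ∈ F) :
    ∀ᵐ S ∂(μ : Measure (QuadConfig (Set.univ : Set ℂ))), Ψ D S ∈ F := by
  rcases F.eq_empty_or_nonempty with rfl | hne
  · exfalso
    obtain ⟨n, hn⟩ := hev.exists
    exact hn ∅
  have hbd : ∀ x y : CurveClass ℂ,
      dist ((⟨fun γ => min 1 (Metric.infDist γ F),
        continuous_const.min (Metric.continuous_infDist_pt F)⟩ : C(CurveClass ℂ, ℝ)) x)
        ((⟨fun γ => min 1 (Metric.infDist γ F),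
        continuous_const.min (Metric.continuous_infDist_pt F)⟩ : C(CurveClass ℂ, ℝ)) y) ≤ 1 := by
    intro x y
    have hx0 : 0 ≤ min 1 (Metric.infDist x F) := le_min zero_le_one Metric.infDist_nonneg
    have hx1 : min 1 (Metric.infDist x F) ≤ 1 := min_le_left _ _
    have hy0 : 0 ≤ min 1 (Metric.infDist y F) := le_min zero_le_one Metric.infDist_nonneg
    have hy1 : min 1 (Metric.infDist y F) ≤ 1 := min_le_left _ _
    rw [ContinuousMap.coe_mk, Real.dist_eq]
    exact abs_sub_le_iff.2 ⟨by linarith, by linarith⟩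
  set g : CurveClass ℂ →ᵇ ℝ := BoundedContinuousFunction.mkOfBound
    ⟨fun γ => min 1 (Metric.infDist γ F), continuous_const.min (Metric.continuous_infDist_pt F)⟩
    1 hbd with hg
  have hg_apply : ∀ γ, g γ = min 1 (Metric.infDist γ F) := fun γ => rfl
  have hg_nonneg : ∀ γ, 0 ≤ g γ := fun γ => le_min zero_le_one Metric.infDist_nonneg
  have hg_zero : ∀ γ, g γ = 0 ↔ γ ∈ F := by
    intro γ
    rw [hg_apply, hF.mem_iff_infDist_zero hne]
    constructor
    · intro h
      rcases min_eq_iff.1 h with ⟨h1, -⟩ | ⟨h2, -⟩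
      · norm_num at h1
      · exact h2
    · intro h
      rw [h]
      exact min_eq_right zero_le_one
  have hlim := h3D (g.compContinuous ⟨Prod.snd, continuous_snd⟩)
  simp only [BoundedContinuousFunction.compContinuous_apply, ContinuousMap.coe_mk] at hlim
  have hzero : ∫ S, g (Ψ D S) ∂(μ : Measure (QuadConfig (Set.univ : Set ℂ))) = 0 := by
    refine tendsto_nhds_unique hlim (tendsto_const_nhds.congr' ?_)
    filter_upwards [hev] with n hn
    exact (integral_eq_zero_of_ae (Eventually.of_forall fun ω => (hg_zero _).2 (hn ω))).symm
  have hint : Integrable (fun S => g (Ψ D S)) (μ : Measure (QuadConfig (Set.univ : Set ℂ))) :=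
    Integrable.of_bound (g.continuous.measurable.comp hΨ).aestronglyMeasurable ‖g‖
      (Eventually.of_forall fun S => g.norm_coe_le_norm (Ψ D S))
  have hae := (integral_eq_zero_iff_of_nonneg (fun S => hg_nonneg _) hint).1 hzero
  filter_upwards [hae] with S hS
  exact (hg_zero _).1 hS

/-! ### The `IsChordal` conjunct of `stub_freeAxioms` -/

/-- The set of chordal curve classes of `(D; a, b)` (from `a` to `b` inside `D̄`) is closed. -/
theorem isClosed_setOf_chordal (D : DobrushinDomain) :
    IsClosed {γ : CurveClass ℂ | γ.source = D.pt 0 ∧ γ.target = D.pt 1 ∧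
      γ.range ⊆ closure D.carrier} :=
  (isClosed_eq CurveClass.continuous_source continuous_const).inter
    ((isClosed_eq CurveClass.continuous_target continuous_const).inter
      (CurveClass.isClosed_rangeSubset isClosed_closure))

/-- The approximate chordal events (start within `ρ` of `a`, end within `ρ` of `b`, trace in the
closed `ρ`-neighbourhood of `D̄`) are closed. -/
theorem isClosed_setOf_near (D : DobrushinDomain) (ρ : ℝ) :
    IsClosed {γ : CurveClass ℂ | dist γ.source (D.pt 0) ≤ ρ ∧ dist γ.target (D.pt 1) ≤ ρ ∧
      γ.range ⊆ Metric.cthickening ρ (closure D.carrier)} :=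
  (isClosed_le (CurveClass.continuous_source.dist continuous_const) continuous_const).inter
    ((isClosed_le (CurveClass.continuous_target.dist continuous_const) continuous_const).inter
      (CurveClass.isClosed_rangeSubset Metric.isClosed_cthickening))

/-- **The `IsChordal` conjunct of `stub_freeAxioms`.** For a Borel reading `Ψ` to which the
lattice interfaces hand off jointly along every quad-convergent positive null mesh sequence, if
every Dobrushin domain is `ℤ²`-discretisable then for every subsequential quad-crossing limit
`μ` the family `P D := (Ψ D)_* μ` is chordal: each `P D` is a probability measure carried by
curve classes from `a = D.pt 0` to `b = D.pt 1` with trace in `closure D`. -/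
theorem isChordal_of_handsOff : ∀ Ψ : DobrushinDomain → QuadConfig (Set.univ : Set ℂ) → CurveClass ℂ, (∀ D : DobrushinDomain, Measurable (Ψ D)) → (∀ (μ : FiniteMeasure (QuadConfig (Set.univ : Set ℂ))) (δs : ℕ → ℝ), (∀ n, 0 < δs n) → Tendsto δs atTop (𝓝 0) → Tendsto (fun n => z2QuadLaw (Set.univ : Set ℂ) (δs n)) atTop (𝓝 μ) → ∀ (D : DobrushinDomain) (E : ℝ → DiscreteDobrushin), ZdDiscretisationFamily D E → ∀ f : (QuadConfig (Set.univ : Set ℂ) × CurveClass ℂ) →ᵇ ℝ, Tendsto (fun n => ∫ ω, f (z2QuadConfig (Set.univ : Set ℂ) (δs n) ω, bondInterfaceIn D (E (δs n)) ω) ∂(bondPercolation (zdGraph 2) half)) atTop (𝓝 (∫ S, f (S, Ψ D S) ∂(μ : Measure (QuadConfig (Set.univ : Set ℂ)))))) → (∀ D : DobrushinDomain, ∃ E : ℝ → DiscreteDobrushin, ZdDiscretisationFamily D E) → ∀ μ ∈ subseqQuadLimits (Set.univ : Set ℂ), ChordalFamily.IsChordal (fun D => (μ : Measure (QuadConfig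 (Set.univ : Set ℂ))).map (Ψ D)) := by
  intro Ψ h1 h3 h4 μ hμ D
  haveI : IsProbabilityMeasure (μ : Measure (QuadConfig (Set.univ : Set ℂ))) :=
    isProbabilityMeasure_of_isSubseqQuadLimit isOpen_univ hμ
  refine ⟨Measure.isProbabilityMeasure_map (h1 D).aemeasurable, ?_⟩
  obtain ⟨δs, hpos, hlim, hconv⟩ := (isSubseqQuadLimit_iff Set.univ μ).1 hμ
  obtain ⟨E, hE⟩ := h4 D
  have h3D := h3 μ δs hpos hlim hconv D E hE
  have hδs : Tendsto δs atTop (𝓝[>] 0) :=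
    tendsto_nhdsWithin_iff.2 ⟨hlim, Eventually.of_forall hpos⟩
  have hk : ∀ k : ℕ, ∀ᵐ S ∂(μ : Measure (QuadConfig (Set.univ : Set ℂ))),
      Ψ D S ∈ {γ : CurveClass ℂ | dist γ.source (D.pt 0) ≤ 1 / ((k : ℝ) + 1) ∧
        dist γ.target (D.pt 1) ≤ 1 / ((k : ℝ) + 1) ∧
        γ.range ⊆ Metric.cthickening (1 / ((k : ℝ) + 1)) (closure D.carrier)} := fun k =>
    ae_mem_of_handsOff h3D (h1 D) (isClosed_setOf_near D _)
      (hδs.eventually (eventually_forall_bondInterfaceIn_near D hE (by positivity)))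
  change ∀ᵐ γ ∂((μ : Measure (QuadConfig (Set.univ : Set ℂ))).map (Ψ D)),
    γ.source = D.pt 0 ∧ γ.target = D.pt 1 ∧ γ.range ⊆ closure D.carrier
  rw [ae_map_iff (h1 D).aemeasurable (isClosed_setOf_chordal D).measurableSet]
  filter_upwards [ae_all_iff.2 hk] with S hS
  refine ⟨?_, ?_, ?_⟩
  · refine dist_le_zero.1 (le_of_not_gt fun h => ?_)
    obtain ⟨k, hk⟩ := exists_nat_one_div_lt h
    exact (hS k).1.not_gt hk
  · refine dist_le_zero.1 (le_of_not_gt fun h => ?_)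
    obtain ⟨k, hk⟩ := exists_nat_one_div_lt h
    exact (hS k).2.1.not_gt hk
  · intro z hz
    rw [← closure_closure (s := D.carrier), Metric.closure_eq_iInter_cthickening]
    simp only [Set.mem_iInter]
    intro ε hε
    obtain ⟨k, hk⟩ := exists_nat_one_div_lt hε
    exact Metric.cthickening_mono hk.le _ ((hS k).2.2 hz)

end Summit.CriticalPhenomena.CardyFormulaZ2.Cruxes.LagHandOff.CrosscutDictionary

end
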